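import Literature.NumberTheory.Rogawski1990.ArchBouazizClassTube            -- ★ p851533 (LH3-p04 (g5)): per-place invariants, `exists_pos_not_split_and_compact_near`, tubes at a REGULAR class
import Literature.NumberTheory.Rogawski1990.ArchBouazizClassMapClosedRange  -- ★ p851511 (F0P3a-p09 (g8)): `isClosed_range_bzClassMap`
import Literature.NumberTheory.Rogawski1990.ArchBouazizClassMapFibre        -- ★ p851515 (LH10-p02 (g7)): `apply_eq_of_bzClassMap_eq` (invariant functions are constant on fibres)
import Mathlib.Analysis.SpecialFunctions.Trigonometric.Bounds               -- Jordan `Real.mul_le_sin`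
import Mathlib.Analysis.SpecialFunctions.Trigonometric.Series               -- `Real.hasSum_cosh`
import HarnessLib

/-!
# CLASS TUBES AT A WALL BASE CLASS: chart types off the central places, the fibre neighbourhood of a tube, fibre points on the walls, and
# «a move-invariant set containing a ball around one fibre point contains a class tube» (Bouaziz 1994 §5.1–5.2; Shelstad 1979 §4; Rogawski 1990 §3.6, §8.2)

Topic `NumberTheory/Rogawski1990`; namespace `Literature.NumberTheory.Rogawski1990`.  THEOREMS ONLY (no `def`, no instance, no notation, no axiom, no named fact,
no `sorry`); group-free over a finite index type `W`.  Cell `pub/hodgecm-mathlib`, crux H413 (`stmt-HodgeConjecture-24833`), line LH3 (closer stub `stub_N9`), letter L3′,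
SURJ-OF-FORWARD road (RULINGS #22∕#23∕#26, LH3-plan (g4)), organ **(Σ-WALL)** «local surjectivity of `fH ↦ stOrbFamH νH fH` at a WALL base class» — the FILTRATION ROAD of
LH3-p01 (g6)'s W-ROAD CENSUS v1 (`F0/P3c/LH3/LH3-p01/g6/wall/W-ROAD-CENSUS.v1.LH3p01g6.md`), brick **(W0) «CLASS-MAP TUBE AT A WALL CLASS»** (RULING #26: hand LH1-p03 (g7)).
The REGULAR-class tubes are ★ `ArchBouazizClassTube` (LH3-p04 (g5)); this file is their COROLLARY at an ARBITRARY base class `b` (no hypothesis on `b` anywhere: off the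
closed class images every tube statement is vacuous for small radius) and restates nothing.  Author LH1-p03 (g7).  Count-neutral.

NOTATION (never a `def`; always the inline predicate).  `b : W → ℂ × ℂ × ℂ` a base class datum; the CENTRAL places of `b` are `Z(b) = {w | (b w).1 ^ 2 = 4 * (b w).2.1}`
(the `hwall`∕`hreg` token of ★ `bouazizSurjOfForward_of_parts`: double block eigenvalue; on a class image this is `‖(b w).1‖ = 2`, the value `(2e^{iφ}, e^{2iφ}, e^{iu})`, which
is BOTH the compact value `θ₀ = θ₂ = φ` and the split value `x = 0, θ = φ`); the class TUBE of radius `ε` of the chart `S` is `{c | dist (bzClassMap S c) b < ε}`; the FIBRE is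
`{c | bzClassMap S c = b}`; the MOVES of the chart `S` are the angle shifts `c + angleShift w i k` (`w ∉ S ∨ i ≠ 0`), the flips `flipAt w` (`w ∉ S`) and the sign changes
`negXAt w` (`w ∈ S`) (★ `ArchCartanCoordinates`), all isometries of the sup metric.

* §1 Elementary liftings (place-free): `exists_int_abs_sub_le_of_circleExp` (Jordan: an angle is `(π∕2)·‖e^{ia} − e^{ia₀}‖`-close to a `2π`-translate of `a₀`),
  `norm_sub_mul_norm_sub_le` (equal-sum∕product estimate for an eigenvalue pair: `‖α−α₀‖·‖α−β₀‖ ≤ ‖α‖·‖(α+β)−(α₀+β₀)‖ + ‖αβ−α₀β₀‖`), `sq_abs_sub_abs_le_two_mul_abs_cosh_sub`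
  (`(|x|−|x₀|)² ≤ 2|cosh x − cosh x₀|`).
* §2 **(W0a) CHART TYPE IS DETERMINED OFF `Z(b)`**: `exists_forall_mem_iff_of_dist_bzClassMap_lt` — one radius `ε > 0` such that two charts with points in the `ε`-tube agree at
  every place off `Z(b)` (W-fold minimum of ★ `exists_pos_not_split_and_compact_near`; ★ T2 `exists_forall_chart_eq_of_dist_bzClassMap_lt` is the case `Z(b) = ∅`), and the
  literal «`S_T = S₀ ∪ T`» reading `eq_filter_union_filter_of_forall_mem_iff`.
* §3 **(W0b) THE TUBE LIES IN THE `δ`-NEIGHBOURHOOD OF THE FIBRE**: per place (`exists_near_fibre_of_not_mem` compact, `exists_near_fibre_of_mem` split — ALL THREE coordinates are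
  located, at wall values too, no regularity used; ★ ED. 2 of `ArchBouazizClassTube` §3 gives the complementary smallness of the wall coordinate alone) and assembled
  `exists_forall_exists_eq_dist_lt_of_dist_bzClassMap_lt (b) (S) (hδ) : ∃ ε > 0, ∀ c, dist (bzClassMap S c) b < ε → ∃ c′, bzClassMap S c′ = b ∧ dist c c′ < δ`.
* §4 **(W0c) EVERY CHART OF THE RIGHT TYPE OFF `Z(b)` SEES `b`, WITH A FIBRE POINT ON THE WALLS**: `exists_bzClassMap_eq_of_forall_mem_iff`.
* §5 **(W0d) FIBRE = ORBIT, invariant-set form** (`mem_of_bzClassMap_eq_of_invariant`, over ★ `apply_eq_of_bzClassMap_eq` applied to an indicator), the isometry of the moves, and the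
  CONSUMER HEAD **(W0-main) `exists_forall_mem_of_dist_bzClassMap_lt`** («`∀ δ, ∃ ε, ∀ U`», radius before the set): a move-invariant set containing a ball around ONE fibre point
  contains a class tube — how a (P)(W)-symmetric local statement proved near one fibre point `c_T` ((W1′) smooth germ, (W2) class function, (G3) non-vanishing; (W12-asm), (W3-asm))
  becomes the clause «`∀ c ∈ RegS S_T, dist (bzClassMap S_T c) b < ε → …`» of `hwall`.
HONEST LABEL: L3′ = «S-road organ-complete modulo (Σ-WALL) PRINT» until the W-bricks are ★; HC_CM is proved only modulo the 7 printed citations (2 remaining: hLiu418 =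
stmt-HodgeConjecture-24832, h413 = stmt-HodgeConjecture-24833) until rung 0 closes; coordinate bookkeeping, pays nothing by itself.

## References
* [Bouaziz1994IntegralesOrbitales] A. Bouaziz, *Intégrales orbitales sur les groupes de Lie réductifs*, Ann. Sci. ÉNS (4) 27 (1994) 573–609, §2.3 Lemme 2.3.1 p. 578, §5.1 p. 588
  («bon voisinage de chaque élément semi-simple»), §5.2 p. 588 (descent at a semisimple element).
* [Shelstad1979] D. Shelstad, *Characters and inner forms of a quasi-split group over ℝ*, Compositio Math. 39 (1979), §4 pp. 22–25 (Cartan data, the Cayley point).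
* [Rogawski1990] J. D. Rogawski, *Automorphic Representations of Unitary Groups in Three Variables*, Ann. of Math. Stud. 123 (1990), §3.6 p. 31, §8.2 p. 122.
-/

set_option autoImplicit false

noncomputable section

open Complex Set Function Real Metric
open Literature.NumberTheory.Automorphic.ArchCartan

namespace Literature.NumberTheory.Rogawski1990

variable {W : Type*}

/-! ## §1 Elementary liftings -/

section Liftings

/-- Jordan's inequality on the half angle: `|d| ≤ π · |sin(d∕2)|` for `|d| ≤ π` (Mathlib `Real.mul_le_sin`). [cite: Shelstad1979, §4 p. 22] -/
theorem abs_le_pi_mul_abs_sin_half {d : ℝ} (hd : |d| ≤ π) : |d| ≤ π * |Real.sin (d / 2)| := by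
  have h0 : 0 ≤ |d| / 2 := by positivity
  have h1 : |d| / 2 ≤ π / 2 := by linarith
  have hJ := Real.mul_le_sin h0 h1
  have hsin : Real.sin (|d| / 2) = |Real.sin (d / 2)| := by
    rcases le_or_gt 0 d with hd0 | hd0
    · rw [abs_of_nonneg hd0, abs_of_nonneg (Real.sin_nonneg_of_nonneg_of_le_pi (by linarith) (by linarith [abs_of_nonneg hd0 ▸ hd]))]
    · have hneg : d < 0 := hd0
      rw [abs_of_neg hneg, show -d / 2 = -(d / 2) by ring, Real.sin_neg,
        abs_of_nonpos (Real.sin_nonpos_of_nonpos_of_neg_pi_le (by linarith) (by linarith [abs_of_neg hneg ▸ hd]))]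
  rw [← hsin]
  have hπ : 0 < π := Real.pi_pos
  calc |d| = π * (2 / π * (|d| / 2)) := by field_simp
    _ ≤ π * Real.sin (|d| / 2) := mul_le_mul_of_nonneg_left hJ hπ.le

/-- **LIFTING AN ANGLE THROUGH `Circle.exp`**: `a` is `(π∕2)·‖e^{ia} − e^{ia₀}‖`-close to a `2π`-translate of `a₀` (`‖e^{id} − 1‖ = 2|sin(d∕2)|` and Jordan).
[cite: Shelstad1979, §4 p. 22] [cite: Bouaziz1994IntegralesOrbitales, §2.3 p. 578] -/
theorem exists_int_abs_sub_le_of_circleExp (a a₀ : ℝ) :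
    ∃ k : ℤ, |a - (a₀ + k * (2 * π))| ≤ π / 2 * ‖(Circle.exp a : ℂ) - (Circle.exp a₀ : ℂ)‖ := by
  -- the principal determination `d ∈ (−π, π]` of `a − a₀`
  set z : Circle := Circle.exp (a - a₀) with hz
  set d : ℝ := (z : ℂ).arg with hd
  have hdz : Circle.exp d = z := Circle.exp_arg z
  have hdπ : |d| ≤ π := abs_le.2 ⟨(Complex.neg_pi_lt_arg _).le, Complex.arg_le_pi _⟩
  obtain ⟨m, hm⟩ := Circle.exp_eq_exp.1 (hdz.trans hz)
  refine ⟨-m, ?_⟩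
  have hsub : a - (a₀ + ((-m : ℤ) : ℝ) * (2 * π)) = d := by rw [hm]; push_cast; ring
  rw [hsub]
  -- `‖e^{ia} − e^{ia₀}‖ = ‖e^{id} − 1‖ = 2|sin(d/2)|`
  have hnorm : ‖(Circle.exp a : ℂ) - (Circle.exp a₀ : ℂ)‖ = 2 * |Real.sin (d / 2)| := by
    have h1 : (Circle.exp a : ℂ) - (Circle.exp a₀ : ℂ) = (Circle.exp a₀ : ℂ) * ((Circle.exp d : ℂ) - 1) := by
      rw [hdz, hz, Circle.exp_sub, Circle.coe_div, mul_sub, mul_one, mul_div_cancel₀ _ (Circle.coe_ne_zero _)]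
    rw [h1, norm_mul, Circle.norm_coe, one_mul, Circle.coe_exp, mul_comm (d : ℂ) I, Complex.norm_exp_I_mul_ofReal_sub_one, Real.norm_eq_abs, abs_mul,
      abs_of_pos (by norm_num : (0 : ℝ) < 2)]
  rw [hnorm]
  have h := abs_le_pi_mul_abs_sin_half hdπ
  linarith

/-- **EQUAL SUM AND PRODUCT ⇒ THE PAIR IS CLOSE UP TO ORDER**: `‖α − α₀‖·‖α − β₀‖ ≤ ‖α‖·‖(α+β) − (α₀+β₀)‖ + ‖αβ − α₀β₀‖` (expand `(α−α₀)(α−β₀)` and use `α² − (α+β)α + αβ = 0`).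
[cite: Rogawski1990, §8.2 p. 122] -/
theorem norm_sub_mul_norm_sub_le (α β α₀ β₀ : ℂ) :
    ‖α - α₀‖ * ‖α - β₀‖ ≤ ‖α‖ * ‖α + β - (α₀ + β₀)‖ + ‖α * β - α₀ * β₀‖ := by
  have h : (α - α₀) * (α - β₀) = α * (α + β - (α₀ + β₀)) - (α * β - α₀ * β₀) := by ring
  rw [← norm_mul, h]
  exact (norm_sub_le _ _).trans (by rw [norm_mul])

/-- From a product bound to one small factor: `‖u‖·‖v‖ ≤ η²` ⇒ `‖u‖ ≤ η ∨ ‖v‖ ≤ η`. [folklore] -/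
private theorem norm_le_or_norm_le_of_mul_le_sq {u v : ℂ} {η : ℝ} (hη : 0 ≤ η) (h : ‖u‖ * ‖v‖ ≤ η ^ 2) : ‖u‖ ≤ η ∨ ‖v‖ ≤ η := by
  by_contra hc
  push Not at hc
  have : η ^ 2 < ‖u‖ * ‖v‖ := by nlinarith [hc.1, hc.2, norm_nonneg u, norm_nonneg v]
  exact absurd h (not_le.2 this)

/-- `1 + y²∕2 ≤ cosh y` (the first two terms of the even power series `Real.hasSum_cosh`). [folklore] -/
private theorem one_add_sq_div_two_le_cosh (y : ℝ) : 1 + y ^ 2 / 2 ≤ Real.cosh y := by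
  have h := Real.hasSum_cosh y
  have h2 := sum_le_hasSum (Finset.range 2) (fun n _ => div_nonneg (by rw [pow_mul]; exact pow_nonneg (sq_nonneg y) n) (Nat.cast_nonneg _)) h
  have hs : ∑ n ∈ Finset.range 2, y ^ (2 * n) / ((2 * n).factorial : ℝ) = 1 + y ^ 2 / 2 := by
    rw [Finset.sum_range_succ, Finset.sum_range_succ, Finset.sum_range_zero]
    norm_num [Nat.factorial]
  linarith

/-- **`(|x| − |x₀|)² ≤ 2·|cosh x − cosh x₀|`** (for `0 ≤ b ≤ a`: `cosh a = cosh b cosh(a−b) + sinh b sinh(a−b) ≥ cosh b · (1 + (a−b)²∕2) ≥ cosh b + (a−b)²∕2`).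
[cite: Rogawski1990, §3.6 p. 31] -/
theorem sq_abs_sub_abs_le_two_mul_abs_cosh_sub (x x₀ : ℝ) : (|x| - |x₀|) ^ 2 ≤ 2 * |Real.cosh x - Real.cosh x₀| := by
  -- reduce to `0 ≤ b ≤ a`
  have key : ∀ a b : ℝ, 0 ≤ b → b ≤ a → (a - b) ^ 2 ≤ 2 * (Real.cosh a - Real.cosh b) := by
    intro a b hb hab
    have hadd : Real.cosh a = Real.cosh b * Real.cosh (a - b) + Real.sinh b * Real.sinh (a - b) := by
      rw [← Real.cosh_add]; congr 1; ring
    have h1 := one_add_sq_div_two_le_cosh (a - b)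
    have h2 : 0 ≤ Real.sinh b := Real.sinh_nonneg_iff.2 hb
    have h3 : 0 ≤ Real.sinh (a - b) := Real.sinh_nonneg_iff.2 (by linarith)
    have h4 : 1 ≤ Real.cosh b := Real.one_le_cosh b
    nlinarith [mul_le_mul_of_nonneg_left h1 (zero_le_one.trans h4), mul_nonneg h2 h3, sq_nonneg (a - b)]
  rw [← Real.cosh_abs x, ← Real.cosh_abs x₀]
  rcases le_total |x₀| |x| with h | h
  · have h1 := key |x| |x₀| (abs_nonneg _) h
    have h0 : 0 ≤ Real.cosh |x| - Real.cosh |x₀| := by nlinarith [sq_nonneg (|x| - |x₀|)]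
    rwa [abs_of_nonneg h0]
  · have h1 := key |x₀| |x| (abs_nonneg _) h
    have h0 : 0 ≤ Real.cosh |x₀| - Real.cosh |x| := by nlinarith [sq_nonneg (|x₀| - |x|)]
    rw [abs_sub_comm, abs_of_nonneg h0]
    nlinarith [h1]

end Liftings

/-! ## §2 (W0a) The chart type is determined off the central places `Z(b)` -/

section ChartType

variable [Fintype W]

/-- A positive lower bound for finitely many positive numbers. [folklore] -/
private theorem exists_pos_forall_le (δ : W → ℝ) (hδ : ∀ w, 0 < δ w) : ∃ ε : ℝ, 0 < ε ∧ ∀ w, ε ≤ δ w := by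
  by_cases hW : (Finset.univ : Finset W).Nonempty
  · exact ⟨Finset.univ.inf' hW δ, (Finset.lt_inf'_iff hW).2 fun w _ => hδ w, fun w => Finset.inf'_le _ (Finset.mem_univ w)⟩
  · exact ⟨1, one_pos, fun w => absurd ⟨w, Finset.mem_univ w⟩ hW⟩

variable [DecidableEq W]

/-- **(W0a) THE CHART TYPE IS DETERMINED OFF `Z(b)`.**  For every base class datum `b` there is `ε > 0` such that two charts `S, S′` having points `c, c′` in the `ε`-tube of `b`
AGREE at every place `w` off `Z(b)` (`(b w).1² ≠ 4·(b w).2.1`): at such a place a split value and a compact value cannot both be `ε`-near `b w` (★ `exists_pos_not_split_and_compact_near`,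
the sign of the real invariant `t²·conj d − 4`).  No hypothesis on `b`; at the places of `Z(b)` nothing is claimed (both types occur).  ★ `exists_forall_chart_eq_of_dist_bzClassMap_lt`
is the case `Z(b) = ∅`. [cite: Bouaziz1994IntegralesOrbitales, §5.1 p. 588] [cite: Shelstad1979, §4 p. 23] -/
theorem exists_forall_mem_iff_of_dist_bzClassMap_lt (b : W → ℂ × ℂ × ℂ) :
    ∃ ε : ℝ, 0 < ε ∧ ∀ (S S' : Finset W) (c c' : W → Fin 3 → ℝ), dist (bzClassMap S c) b < ε → dist (bzClassMap S' c') b < ε →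
      ∀ w, (b w).1 ^ 2 ≠ 4 * (b w).2.1 → (w ∈ S ↔ w ∈ S') := by
  classical
  -- per place: the radius of ★ `exists_pos_not_split_and_compact_near` off `Z(b)`, and `1` on `Z(b)`
  have hδ : ∀ w, ∃ δ : ℝ, 0 < δ ∧ ((b w).1 ^ 2 ≠ 4 * (b w).2.1 → ∀ (S S' : Finset W) (c c' : W → Fin 3 → ℝ), w ∈ S → w ∉ S' →
      dist (bzClassMap S c w) (b w) < δ → dist (bzClassMap S' c' w) (b w) < δ → False) := by
    intro w
    by_cases hw : (b w).1 ^ 2 ≠ 4 * (b w).2.1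
    · obtain ⟨δ, hδ, h⟩ := exists_pos_not_split_and_compact_near (W := W) (b w) hw
      exact ⟨δ, hδ, fun _ S S' c c' hS hS' hd hd' => h S S' c c' w hS hS' hd hd'⟩
    · exact ⟨1, one_pos, fun h => absurd h hw⟩
  choose δ hδ hsep using hδ
  obtain ⟨ε, hε, hεδ⟩ := exists_pos_forall_le δ hδ
  refine ⟨ε, hε, fun S S' c c' hc hc' w hw => ?_⟩
  have hcw : dist (bzClassMap S c w) (b w) < δ w := (dist_bzClassMap_apply_le S c b w).trans_lt (hc.trans_le (hεδ w))
  have hcw' : dist (bzClassMap S' c' w) (b w) < δ w := (dist_bzClassMap_apply_le S' c' b w).trans_lt (hc'.trans_le (hεδ w))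
  by_cases hS : w ∈ S <;> by_cases hS' : w ∈ S'
  · exact iff_of_true hS hS'
  · exact (hsep w hw S S' c c' hS hS' hcw hcw').elim
  · exact (hsep w hw S' S c' c hS' hS hcw' hcw).elim
  · exact iff_of_false hS hS'

omit [Fintype W] in
/-- **«`S_T = S₀ ∪ T`»** — the literal reading of (W0a): if `S′` agrees with a reference chart `S` off `Z(b)`, then `S′` is the split-REGULAR part `S₀ := S.filter (· ∉ Z(b))` of `S`
together with its own central part `T := S′.filter (· ∈ Z(b))`. [cite: Bouaziz1994IntegralesOrbitales, §5.1 p. 588] -/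
theorem eq_filter_union_filter_of_forall_mem_iff (b : W → ℂ × ℂ × ℂ) {S S' : Finset W} (h : ∀ w, (b w).1 ^ 2 ≠ 4 * (b w).2.1 → (w ∈ S ↔ w ∈ S')) :
    S' = S.filter (fun w => (b w).1 ^ 2 ≠ 4 * (b w).2.1) ∪ S'.filter (fun w => (b w).1 ^ 2 = 4 * (b w).2.1) := by
  ext w
  rw [Finset.mem_union, Finset.mem_filter, Finset.mem_filter]
  by_cases hw : (b w).1 ^ 2 = 4 * (b w).2.1
  · constructor
    · exact fun h' => Or.inr ⟨h', hw⟩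
    · rintro (⟨_, hne⟩ | ⟨h', _⟩)
      · exact absurd hw hne
      · exact h'
  · constructor
    · exact fun h' => Or.inl ⟨(h w hw).2 h', hw⟩
    · rintro (⟨hS, _⟩ | ⟨h', _⟩)
      · exact (h w hw).1 hS
      · exact h'

/-- (W0a) packaged with a reference chart: one radius such that every chart with a point in the tube is `S₀ ∪ (its central part)`.
[cite: Bouaziz1994IntegralesOrbitales, §5.1 p. 588] -/
theorem exists_forall_eq_filter_union_filter_of_dist_bzClassMap_lt (b : W → ℂ × ℂ × ℂ) :
    ∃ ε : ℝ, 0 < ε ∧ ∀ (S S' : Finset W) (c c' : W → Fin 3 → ℝ), dist (bzClassMap S c) b < ε → dist (bzClassMap S' c') b < ε →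
      S' = S.filter (fun w => (b w).1 ^ 2 ≠ 4 * (b w).2.1) ∪ S'.filter (fun w => (b w).1 ^ 2 = 4 * (b w).2.1) := by
  obtain ⟨ε, hε, h⟩ := exists_forall_mem_iff_of_dist_bzClassMap_lt b
  exact ⟨ε, hε, fun S S' c c' hc hc' => eq_filter_union_filter_of_forall_mem_iff b (h S S' c c' hc hc')⟩

end ChartType

/-! ## §3 (W0b) The class tube lies in the `δ`-neighbourhood of the fibre -/

section FibreNeighbourhood

variable [DecidableEq W]

/-- The common radius: for `δ > 0` an `E ∈ (0, 1]` with `√E < δ` and `π·(E + √(2E)) < δ` (take `E = min (1∕4) (δ²∕200)`). [folklore] -/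
private theorem exists_radius {δ : ℝ} (hδ : 0 < δ) :
    ∃ E : ℝ, 0 < E ∧ E ≤ 1 ∧ Real.sqrt E < δ ∧ π * (E + Real.sqrt (2 * E)) < δ := by
  set E : ℝ := min (1 / 4 : ℝ) (δ ^ 2 / 200) with hE
  have hE0 : 0 < E := lt_min (by norm_num) (by positivity)
  have hE1 : E ≤ 1 := (min_le_left _ _).trans (by norm_num)
  have hη : Real.sqrt (2 * E) ≤ δ / 10 := by
    rw [show δ / 10 = Real.sqrt ((δ / 10) ^ 2) by rw [Real.sqrt_sq (by positivity)]]
    exact Real.sqrt_le_sqrt (by nlinarith [min_le_right (1 / 4 : ℝ) (δ ^ 2 / 200)])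
  have hE2 : Real.sqrt E ≤ Real.sqrt (2 * E) := Real.sqrt_le_sqrt (by linarith)
  have hEs : E ≤ Real.sqrt E := by
    have h1 : Real.sqrt E ≤ 1 := by rw [← Real.sqrt_one]; exact Real.sqrt_le_sqrt hE1
    calc E = Real.sqrt E * Real.sqrt E := (Real.mul_self_sqrt hE0.le).symm
      _ ≤ Real.sqrt E * 1 := mul_le_mul_of_nonneg_left h1 (Real.sqrt_nonneg _)
      _ = Real.sqrt E := mul_one _
  refine ⟨E, hE0, hE1, by linarith, ?_⟩
  nlinarith [Real.pi_le_four, Real.pi_pos]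

/-- `e^{i(a + k·2π)} = e^{ia}`. [cite: Shelstad1979, §4 p. 22] -/
theorem circleExp_add_int_mul_two_pi (a : ℝ) (k : ℤ) : Circle.exp (a + k * (2 * π)) = Circle.exp a :=
  Circle.exp_eq_exp.2 ⟨k, rfl⟩

/-- **COMPACT PLACE: class data `ε`-near ⇒ the three angles are `δ`-near a fibre representative** (the eigenvalue PAIR is `√(2ε)`-close up to the flip by the equal-sum∕product estimate, each
angle is then lifted through `Circle.exp`; valid at a wall value too — no regularity is used). [cite: Shelstad1979, §4 pp. 22–23] [cite: Rogawski1990, §8.2 p. 122] -/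
theorem exists_near_fibre_of_not_mem {S : Finset W} {w : W} (hw : w ∉ S) (t₀ : Fin 3 → ℝ) {δ : ℝ} (hδ : 0 < δ) :
    ∃ ε : ℝ, 0 < ε ∧ ∀ t : Fin 3 → ℝ, dist (bzClassMap S (fun _ : W => t) w) (bzClassMap S (fun _ : W => t₀) w) < ε →
      ∃ t' : Fin 3 → ℝ, bzClassMap S (fun _ : W => t') w = bzClassMap S (fun _ : W => t₀) w ∧ dist t t' < δ := by
  obtain ⟨E, hE, hE1, hEδ, hπδ⟩ := exists_radius hδ
  refine ⟨E, hE, fun t ht => ?_⟩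
  set η : ℝ := Real.sqrt (2 * E) with hηdef
  have hη0 : 0 ≤ η := Real.sqrt_nonneg _
  have hηsq : η ^ 2 = 2 * E := Real.sq_sqrt (by linarith)
  rw [bzClassMap_of_not_mem hw, bzClassMap_of_not_mem hw, Prod.dist_eq, max_lt_iff, Prod.dist_eq, max_lt_iff] at ht
  obtain ⟨h1, h2, h3⟩ := ht
  rw [dist_eq_norm] at h1 h2 h3
  -- the eigenvalue pair, up to the flip
  obtain ⟨p, q, hsum, hprod, hp, hq⟩ : ∃ p q : ℝ, (Circle.exp p : ℂ) + Circle.exp q = Circle.exp (t₀ 0) + Circle.exp (t₀ 2) ∧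
      (Circle.exp p : ℂ) * Circle.exp q = Circle.exp (t₀ 0) * Circle.exp (t₀ 2) ∧
      ‖(Circle.exp (t 0) : ℂ) - Circle.exp p‖ ≤ η ∧ ‖(Circle.exp (t 2) : ℂ) - Circle.exp q‖ ≤ E + η := by
    have hest := norm_sub_mul_norm_sub_le (Circle.exp (t 0) : ℂ) (Circle.exp (t 2)) (Circle.exp (t₀ 0)) (Circle.exp (t₀ 2))
    rw [Circle.norm_coe, one_mul] at hest
    have hsq : ‖(Circle.exp (t 0) : ℂ) - Circle.exp (t₀ 0)‖ * ‖(Circle.exp (t 0) : ℂ) - Circle.exp (t₀ 2)‖ ≤ η ^ 2 := by rw [hηsq]; linarith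
    rcases norm_le_or_norm_le_of_mul_le_sq hη0 hsq with h | h
    · refine ⟨t₀ 0, t₀ 2, rfl, rfl, h, ?_⟩
      have : (Circle.exp (t 2) : ℂ) - Circle.exp (t₀ 2) =
          ((Circle.exp (t 0) : ℂ) + Circle.exp (t 2) - (Circle.exp (t₀ 0) + Circle.exp (t₀ 2))) - ((Circle.exp (t 0) : ℂ) - Circle.exp (t₀ 0)) := by ring
      rw [this]
      exact (norm_sub_le _ _).trans (by linarith)
    · refine ⟨t₀ 2, t₀ 0, add_comm _ _, mul_comm _ _, h, ?_⟩
      have : (Circle.exp (t 2) : ℂ) - Circle.exp (t₀ 0) =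
          ((Circle.exp (t 0) : ℂ) + Circle.exp (t 2) - (Circle.exp (t₀ 0) + Circle.exp (t₀ 2))) - ((Circle.exp (t 0) : ℂ) - Circle.exp (t₀ 2)) := by ring
      rw [this]
      exact (norm_sub_le _ _).trans (by linarith)
  -- lift the three angles
  obtain ⟨k₀, hk₀⟩ := exists_int_abs_sub_le_of_circleExp (t 0) p
  obtain ⟨k₁, hk₁⟩ := exists_int_abs_sub_le_of_circleExp (t 1) (t₀ 1)
  obtain ⟨k₂, hk₂⟩ := exists_int_abs_sub_le_of_circleExp (t 2) q
  refine ⟨![p + k₀ * (2 * π), t₀ 1 + k₁ * (2 * π), q + k₂ * (2 * π)], ?_, ?_⟩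
  · rw [bzClassMap_of_not_mem hw, bzClassMap_of_not_mem hw]
    simp only [Matrix.cons_val_zero, Matrix.cons_val_one, Matrix.cons_val_two, Matrix.head_cons, Matrix.tail_cons, circleExp_add_int_mul_two_pi]
    rw [hsum, hprod]
  · rw [dist_pi_lt_iff hδ]
    have hπ : 0 < π := Real.pi_pos
    intro i
    fin_cases i
    · show dist (t 0) (p + k₀ * (2 * π)) < δ
      rw [Real.dist_eq]; nlinarith [norm_nonneg ((Circle.exp (t 2) : ℂ) - Circle.exp q)]
    · show dist (t 1) (t₀ 1 + k₁ * (2 * π)) < δ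
      rw [Real.dist_eq]; nlinarith
    · show dist (t 2) (q + k₂ * (2 * π)) < δ
      rw [Real.dist_eq]; nlinarith

/-- `eᵃ + e⁻ᵃ` only depends on `|a|` (`= 2 cosh a`). [folklore] -/
private theorem exp_add_exp_neg_eq_of_abs_eq {a a₀ : ℝ} (h : |a| = |a₀|) : Real.exp a + Real.exp (-a) = Real.exp a₀ + Real.exp (-a₀) := by
  have h1 : Real.cosh a = Real.cosh a₀ := by rw [← Real.cosh_abs, h, Real.cosh_abs]
  rw [Real.cosh_eq, Real.cosh_eq] at h1
  linarith

/-- **SPLIT PLACE: class data `ε`-near ⇒ the coordinates `(x, θ₁, θ)` are `δ`-near a fibre representative** (`(|x|−|x₀|)² ≤ 2|cosh x − cosh x₀| ≤ ‖t − t₀‖`, the sign of `x` matched by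
the sign change `x₀ ↦ ±|x₀|`, the phase `e^{iθ} = t∕‖t‖` with `‖t‖ ≥ 2`, angles lifted through `Circle.exp`; valid at `x₀ = 0`). [cite: Shelstad1979, §4 p. 23] [cite: Rogawski1990, §3.6 p. 31] -/
theorem exists_near_fibre_of_mem {S : Finset W} {w : W} (hw : w ∈ S) (t₀ : Fin 3 → ℝ) {δ : ℝ} (hδ : 0 < δ) :
    ∃ ε : ℝ, 0 < ε ∧ ∀ t : Fin 3 → ℝ, dist (bzClassMap S (fun _ : W => t) w) (bzClassMap S (fun _ : W => t₀) w) < ε →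
      ∃ t' : Fin 3 → ℝ, bzClassMap S (fun _ : W => t') w = bzClassMap S (fun _ : W => t₀) w ∧ dist t t' < δ := by
  obtain ⟨E, hE, hE1, hEδ, hπδ⟩ := exists_radius hδ
  refine ⟨E, hE, fun t ht => ?_⟩
  have hnorm := norm_bzClassMap_tr_of_mem hw (fun _ : W => t)
  have hnorm₀ := norm_bzClassMap_tr_of_mem hw (fun _ : W => t₀)
  rw [bzClassMap_of_mem hw, bzClassMap_of_mem hw, Prod.dist_eq, max_lt_iff, Prod.dist_eq, max_lt_iff] at ht
  rw [bzClassMap_of_mem hw] at hnorm hnorm₀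
  obtain ⟨h1, -, h3⟩ := ht
  rw [dist_eq_norm] at h1 h3
  simp only at h1 h3 hnorm hnorm₀
  set r : ℝ := Real.exp (t 0) + Real.exp (-(t 0)) with hr
  set r₀ : ℝ := Real.exp (t₀ 0) + Real.exp (-(t₀ 0)) with hr₀
  have hr2 : 2 ≤ r := by have := Real.one_le_cosh (t 0); rw [Real.cosh_eq] at this; linarith
  -- (i) the split coordinate: `| |x| − |x₀| | ≤ √E`
  have hrr : |r - r₀| < E := by
    have := abs_norm_sub_norm_le ((r : ℂ) * (Circle.exp (t 2) : ℂ)) ((r₀ : ℂ) * (Circle.exp (t₀ 2) : ℂ))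
    rw [hnorm, hnorm₀] at this
    exact this.trans_lt h1
  have hx : |(|t 0| - |t₀ 0|)| ≤ Real.sqrt E := by
    have hc : (|t 0| - |t₀ 0|) ^ 2 ≤ E := by
      have := sq_abs_sub_abs_le_two_mul_abs_cosh_sub (t 0) (t₀ 0)
      rw [Real.cosh_eq, Real.cosh_eq, ← hr, ← hr₀, show r / 2 - r₀ / 2 = (r - r₀) / 2 by ring, abs_div, abs_of_pos (by norm_num : (0 : ℝ) < 2)] at this
      linarith [hrr.le]
    rw [← Real.sqrt_sq_eq_abs]
    exact Real.sqrt_le_sqrt hc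
  -- the sign-matched representative `x′ = ±|x₀|`
  obtain ⟨x', hx'abs, hx'dist⟩ : ∃ x' : ℝ, |x'| = |t₀ 0| ∧ |t 0 - x'| = |(|t 0| - |t₀ 0|)| := by
    rcases le_or_gt 0 (t 0) with h0 | h0
    · exact ⟨|t₀ 0|, abs_abs _, by rw [abs_of_nonneg h0]⟩
    · refine ⟨-|t₀ 0|, by rw [abs_neg, abs_abs], ?_⟩
      rw [abs_of_neg h0, sub_neg_eq_add, show t 0 + |t₀ 0| = -(-t 0 - |t₀ 0|) by ring, abs_neg]
  -- (ii) the phase: `r·‖e^{iθ} − e^{iθ₀}‖ < 2E ≤ r·E`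
  have hθ : ‖(Circle.exp (t 2) : ℂ) - Circle.exp (t₀ 2)‖ < E := by
    have hkey : r * ‖(Circle.exp (t 2) : ℂ) - Circle.exp (t₀ 2)‖ < 2 * E := by
      have e1 : (r : ℂ) * Circle.exp (t 2) - (r : ℂ) * Circle.exp (t₀ 2) =
          ((r : ℂ) * Circle.exp (t 2) - (r₀ : ℂ) * Circle.exp (t₀ 2)) + (((r₀ - r : ℝ) : ℂ)) * Circle.exp (t₀ 2) := by push_cast; ring
      have hn : ‖(r : ℂ) * Circle.exp (t 2) - (r : ℂ) * Circle.exp (t₀ 2)‖ = r * ‖(Circle.exp (t 2) : ℂ) - Circle.exp (t₀ 2)‖ := by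
        rw [← mul_sub, norm_mul, Complex.norm_real, Real.norm_eq_abs, abs_of_pos (by linarith)]
      rw [← hn, e1]
      refine (norm_add_le _ _).trans_lt ?_
      rw [norm_mul, Circle.norm_coe, mul_one, Complex.norm_real, Real.norm_eq_abs, abs_sub_comm]
      linarith
    nlinarith [norm_nonneg ((Circle.exp (t 2) : ℂ) - Circle.exp (t₀ 2))]
  -- (iii) lift the two angles
  obtain ⟨k₁, hk₁⟩ := exists_int_abs_sub_le_of_circleExp (t 1) (t₀ 1)
  obtain ⟨k₂, hk₂⟩ := exists_int_abs_sub_le_of_circleExp (t 2) (t₀ 2)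
  refine ⟨![x', t₀ 1 + k₁ * (2 * π), t₀ 2 + k₂ * (2 * π)], ?_, ?_⟩
  · rw [bzClassMap_of_mem hw, bzClassMap_of_mem hw]
    simp only [Matrix.cons_val_zero, Matrix.cons_val_one, Matrix.cons_val_two, Matrix.head_cons, Matrix.tail_cons, circleExp_add_int_mul_two_pi]
    rw [exp_add_exp_neg_eq_of_abs_eq hx'abs]
  · rw [dist_pi_lt_iff hδ]
    have hπ : 0 < π := Real.pi_pos
    have hsq2 : 0 ≤ Real.sqrt (2 * E) := Real.sqrt_nonneg _
    intro i
    fin_cases i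
    · show dist (t 0) x' < δ
      rw [Real.dist_eq, hx'dist]; exact hx.trans_lt hEδ
    · show dist (t 1) (t₀ 1 + k₁ * (2 * π)) < δ
      rw [Real.dist_eq]; nlinarith
    · show dist (t 2) (t₀ 2 + k₂ * (2 * π)) < δ
      rw [Real.dist_eq]; nlinarith [norm_nonneg ((Circle.exp (t 2) : ℂ) - Circle.exp (t₀ 2))]

variable [Fintype W]

/-- **(W0b) THE CLASS TUBE LIES IN THE `δ`-NEIGHBOURHOOD OF THE FIBRE.**  For every base class datum `b`, chart `S` and `δ > 0` there is `ε > 0` such that every chart point whose class is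
`ε`-near `b` is `δ`-near (sup metric on `W → Fin 3 → ℝ`) a point of the FIBRE `{c′ | bzClassMap S c′ = b}` — place by place (§3), and vacuously when `b` is off the closed class image
(★ `isClosed_range_bzClassMap`).  No hypothesis on `b`: wall values included. [cite: Bouaziz1994IntegralesOrbitales, §2.3 Lemme 2.3.1; §5.1 p. 588] [cite: Shelstad1979, §4 pp. 22–23] -/
theorem exists_forall_exists_eq_dist_lt_of_dist_bzClassMap_lt (b : W → ℂ × ℂ × ℂ) (S : Finset W) {δ : ℝ} (hδ : 0 < δ) :
    ∃ ε : ℝ, 0 < ε ∧ ∀ c : W → Fin 3 → ℝ, dist (bzClassMap S c) b < ε → ∃ c' : W → Fin 3 → ℝ, bzClassMap S c' = b ∧ dist c c' < δ := by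
  by_cases hb : b ∈ Set.range (bzClassMap S)
  · obtain ⟨c₀, rfl⟩ := hb
    have hw : ∀ w, ∃ ε : ℝ, 0 < ε ∧ ∀ t : Fin 3 → ℝ, dist (bzClassMap S (fun _ : W => t) w) (bzClassMap S (fun _ : W => c₀ w) w) < ε →
        ∃ t' : Fin 3 → ℝ, bzClassMap S (fun _ : W => t') w = bzClassMap S (fun _ : W => c₀ w) w ∧ dist t t' < δ := fun w => by
      by_cases hw : w ∈ S
      · exact exists_near_fibre_of_mem hw (c₀ w) hδ
      · exact exists_near_fibre_of_not_mem hw (c₀ w) hδ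
    choose ε hε hnear using hw
    obtain ⟨ε₀, hε₀, hle⟩ := exists_pos_forall_le ε hε
    refine ⟨ε₀, hε₀, fun c hc => ?_⟩
    have hcw : ∀ w, dist (bzClassMap S (fun _ : W => c w) w) (bzClassMap S (fun _ : W => c₀ w) w) < ε w := fun w => by
      rw [← bzClassMap_congr S (c := c) (c' := fun _ : W => c w) rfl, ← bzClassMap_congr S (c := c₀) (c' := fun _ : W => c₀ w) rfl]
      exact (dist_bzClassMap_apply_le S c (bzClassMap S c₀) w).trans_lt (hc.trans_le (hle w))
    choose t' ht' hdist using fun w => hnear w (c w) (hcw w)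
    refine ⟨fun w => t' w, funext fun w => ?_, (dist_pi_lt_iff hδ).2 fun w => hdist w⟩
    rw [bzClassMap_congr S (c := fun w => t' w) (c' := fun _ : W => t' w) rfl, ht' w, bzClassMap_congr S (c := fun _ : W => c₀ w) (c' := c₀) rfl]
  · obtain ⟨ε, hε, hball⟩ := Metric.isOpen_iff.1 (isClosed_range_bzClassMap S).isOpen_compl b hb
    exact ⟨ε, hε, fun c hc => absurd ⟨c, rfl⟩ (hball (Metric.mem_ball.2 hc))⟩

end FibreNeighbourhood

/-! ## §4 (W0c) Every chart of the right type off `Z(b)` sees `b`, with a fibre point ON the walls -/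

section FibrePoint

variable [DecidableEq W]

/-- At a SPLIT place a central class value (`t² = 4d`) forces `x = 0`. [cite: Shelstad1979, §4 p. 25] [cite: Rogawski1990, §3.6 p. 31] -/
theorem coord_zero_eq_zero_of_sq_eq_four_mul {S : Finset W} {w : W} (hw : w ∈ S) {c : W → Fin 3 → ℝ}
    (h : (bzClassMap S c w).1 ^ 2 = 4 * (bzClassMap S c w).2.1) : c w 0 = 0 := by
  have h1 := sq_sub_four_mul_bzClassMap_of_mem hw c
  rw [h, sub_self] at h1
  have h2 : (((Real.exp (c w 0) - Real.exp (-(c w 0))) ^ 2 : ℝ) : ℂ) = 0 := by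
    rcases mul_eq_zero.1 h1.symm with h3 | h3
    · exact h3
    · exact absurd h3 (pow_ne_zero _ (Circle.coe_ne_zero _))
  have h3 : (Real.exp (c w 0) - Real.exp (-(c w 0))) ^ 2 = 0 := by exact_mod_cast h2
  have h4 : Real.exp (c w 0) = Real.exp (-(c w 0)) := sub_eq_zero.1 ((pow_eq_zero_iff two_ne_zero).1 h3)
  have h5 := Real.exp_injective h4
  linarith

/-- At a COMPACT place a central class value (`t² = 4d`) forces `e^{iθ₀} = e^{iθ₂}`. [cite: Shelstad1979, §4 p. 25] [cite: Rogawski1990, §8.2 p. 122] -/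
theorem circleExp_eq_of_sq_eq_four_mul {S : Finset W} {w : W} (hw : w ∉ S) {c : W → Fin 3 → ℝ}
    (h : (bzClassMap S c w).1 ^ 2 = 4 * (bzClassMap S c w).2.1) : Circle.exp (c w 0) = Circle.exp (c w 2) := by
  have h1 := sq_sub_four_mul_bzClassMap_of_not_mem hw c
  rw [h, sub_self] at h1
  exact Circle.ext (sub_eq_zero.1 ((pow_eq_zero_iff two_ne_zero).1 h1.symm))

/-- **(W0c) EVERY CHART OF THE RIGHT TYPE OFF `Z(b)` SEES `b`, WITH A FIBRE POINT ON THE WALLS.**  If `b = bzClassMap S c` and `S′` agrees with `S` at every place off `Z(b)`, then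
`b = bzClassMap S′ c′` for a point `c′` whose coordinates at the central places lie ON the wall of `S′` there (`θ₀ = θ₂` at a compact central place, `x = 0` at a split one): the wall value
`(2e^{iφ}, e^{2iφ}, e^{iu})` is both the compact value `θ₀ = θ₂ = φ` and the split value `x = 0, θ = φ` (the Cayley point ★ `cayPt`).  So the `2^k` charts `S₀ ∪ T`, `T ⊆ Z(b)`, all see `b`.
[cite: Shelstad1979, §4 p. 25] [cite: Bouaziz1994IntegralesOrbitales, §5.2 p. 588] [cite: Rogawski1990, §8.2 p. 122] -/
theorem exists_bzClassMap_eq_of_forall_mem_iff {b : W → ℂ × ℂ × ℂ} {S : Finset W} {c : W → Fin 3 → ℝ} (h : bzClassMap S c = b) (S' : Finset W)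
    (hS' : ∀ w, (b w).1 ^ 2 ≠ 4 * (b w).2.1 → (w ∈ S ↔ w ∈ S')) :
    ∃ c' : W → Fin 3 → ℝ, bzClassMap S' c' = b ∧ (∀ w, w ∉ S' → (b w).1 ^ 2 = 4 * (b w).2.1 → c' w 0 = c' w 2) ∧
      ∀ w, w ∈ S' → (b w).1 ^ 2 = 4 * (b w).2.1 → c' w 0 = 0 := by
  subst h
  -- the wall phase `φ_w` and the new coordinates
  set φ : W → ℝ := fun w => if w ∈ S then c w 2 else c w 0 with hφ
  refine ⟨fun w => if (bzClassMap S c w).1 ^ 2 = 4 * (bzClassMap S c w).2.1 then (if w ∈ S' then ![0, c w 1, φ w] else ![φ w, c w 1, φ w]) else c w,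
    funext fun w => ?_, fun w hw' hz => ?_, fun w hw' hz => ?_⟩
  · by_cases hz : (bzClassMap S c w).1 ^ 2 = 4 * (bzClassMap S c w).2.1
    · -- a central place: the wall value is seen by both chart types
      have hval : ∀ t : Fin 3 → ℝ, bzClassMap S' (fun w' => if (bzClassMap S c w').1 ^ 2 = 4 * (bzClassMap S c w').2.1 then
            (if w' ∈ S' then ![0, c w' 1, φ w'] else ![φ w', c w' 1, φ w']) else c w') w =
          bzClassMap S' (fun _ : W => if w ∈ S' then ![0, c w 1, φ w] else ![φ w, c w 1, φ w]) w := fun t =>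
        bzClassMap_congr S' (by simp only [hz, if_true])
      rw [hval (c w)]
      -- the target value `(2e^{iφ}, e^{2iφ}, e^{iu})`
      have htarget : bzClassMap S c w = ((2 : ℂ) * Circle.exp (φ w), (Circle.exp (φ w) : ℂ) ^ 2, (Circle.exp (c w 1) : ℂ)) := by
        by_cases hw : w ∈ S
        · have hx := coord_zero_eq_zero_of_sq_eq_four_mul hw hz
          rw [bzClassMap_of_mem hw, hx, neg_zero, Real.exp_zero]
          simp only [hφ, hw, if_true]
          norm_num
        · have he := circleExp_eq_of_sq_eq_four_mul hw hz
          rw [bzClassMap_of_not_mem hw, he]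
          simp only [hφ, hw, if_false]
          rw [← he]; refine Prod.ext (by ring) (Prod.ext (by ring) rfl)
      rw [htarget]
      by_cases hw' : w ∈ S'
      · rw [bzClassMap_of_mem hw']
        simp only [hw', if_true, Matrix.cons_val_zero, Matrix.cons_val_one, Matrix.cons_val_two, Matrix.head_cons, Matrix.tail_cons, neg_zero, Real.exp_zero]
        norm_num
      · rw [bzClassMap_of_not_mem hw']
        simp only [hw', if_false, Matrix.cons_val_zero, Matrix.cons_val_one, Matrix.cons_val_two, Matrix.head_cons, Matrix.tail_cons]
        refine Prod.ext (by ring) (Prod.ext (by ring) rfl)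
    · -- a place off `Z(b)`: same chart type, same coordinates
      have hval : bzClassMap S' (fun w' => if (bzClassMap S c w').1 ^ 2 = 4 * (bzClassMap S c w').2.1 then
            (if w' ∈ S' then ![0, c w' 1, φ w'] else ![φ w', c w' 1, φ w']) else c w') w = bzClassMap S' c w :=
        bzClassMap_congr S' (by simp only [hz, if_false])
      rw [hval]
      by_cases hw : w ∈ S
      · rw [bzClassMap_of_mem hw, bzClassMap_of_mem ((hS' w hz).1 hw)]
      · rw [bzClassMap_of_not_mem hw, bzClassMap_of_not_mem (fun h => hw ((hS' w hz).2 h))]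
  · simp only [hz, if_true, hw', if_false, Matrix.cons_val_zero, Matrix.cons_val_two, Matrix.head_cons, Matrix.tail_cons]
  · simp only [hz, if_true, hw', Matrix.cons_val_zero]

end FibrePoint

/-! ## §5 (W0d) Fibre = orbit (invariant-set form), the isometry of the moves, and (W0-main) -/

section Invariant

variable [DecidableEq W]

/-- Shifting back: `c + angleShift w i k + angleShift w i (−k) = c`. [cite: Shelstad1979, §4 p. 22] -/
theorem add_angleShift_add_angleShift_neg (c : W → Fin 3 → ℝ) (w : W) (i : Fin 3) (k : ℤ) : c + angleShift w i k + angleShift w i (-k) = c := by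
  funext w' j
  simp only [Pi.add_apply]
  by_cases hw : w' = w
  · subst hw
    by_cases hj : j = i
    · subst hj; rw [angleShift_apply_self, angleShift_apply_self]; push_cast; ring
    · rw [angleShift_apply_self_of_ne _ hj, angleShift_apply_self_of_ne _ hj]; ring
  · rw [angleShift_apply_of_ne hw, angleShift_apply_of_ne hw, Pi.zero_apply]; ring

/-- Shifting forth: `c + angleShift w i (−k) + angleShift w i k = c`. [cite: Shelstad1979, §4 p. 22] -/
theorem add_angleShift_neg_add_angleShift (c : W → Fin 3 → ℝ) (w : W) (i : Fin 3) (k : ℤ) : c + angleShift w i (-k) + angleShift w i k = c := by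
  simpa only [neg_neg] using add_angleShift_add_angleShift_neg c w i (-k)

variable [Fintype W]

/-- **The flip is an isometry** of the sup metric (it permutes two coordinates). [cite: Shelstad1979, §4 p. 23] -/
theorem dist_flipAt_flipAt (w : W) (x y : W → Fin 3 → ℝ) : dist (flipAt w x) (flipAt w y) = dist x y := by
  have key : ∀ x y : W → Fin 3 → ℝ, dist (flipAt w x) (flipAt w y) ≤ dist x y := by
    intro x y
    refine (dist_pi_le_iff dist_nonneg).2 fun w' => ?_
    by_cases hw : w' = w
    · subst hw
      rw [flipAt_apply_self, flipAt_apply_self]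
      refine (dist_pi_le_iff dist_nonneg).2 fun j => ?_
      fin_cases j
      · exact (dist_le_pi_dist (x w') (y w') 2).trans (dist_le_pi_dist x y w')
      · exact (dist_le_pi_dist (x w') (y w') 1).trans (dist_le_pi_dist x y w')
      · exact (dist_le_pi_dist (x w') (y w') 0).trans (dist_le_pi_dist x y w')
    · rw [flipAt_apply_of_ne hw, flipAt_apply_of_ne hw]
      exact dist_le_pi_dist x y w'
  refine le_antisymm (key x y) ?_
  have := key (flipAt w x) (flipAt w y)
  rwa [flipAt_flipAt, flipAt_flipAt] at this

/-- **The sign change is an isometry** of the sup metric. [cite: Shelstad1979, §4 p. 23] -/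
theorem dist_negXAt_negXAt (w : W) (x y : W → Fin 3 → ℝ) : dist (negXAt w x) (negXAt w y) = dist x y := by
  have key : ∀ x y : W → Fin 3 → ℝ, dist (negXAt w x) (negXAt w y) ≤ dist x y := by
    intro x y
    refine (dist_pi_le_iff dist_nonneg).2 fun w' => ?_
    by_cases hw : w' = w
    · subst hw
      rw [negXAt_apply_self, negXAt_apply_self]
      refine (dist_pi_le_iff dist_nonneg).2 fun j => ?_
      fin_cases j
      · refine le_trans ?_ ((dist_le_pi_dist (x w') (y w') 0).trans (dist_le_pi_dist x y w'))
        show dist (-x w' 0) (-y w' 0) ≤ dist (x w' 0) (y w' 0)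
        rw [dist_neg_neg]
      · exact (dist_le_pi_dist (x w') (y w') 1).trans (dist_le_pi_dist x y w')
      · exact (dist_le_pi_dist (x w') (y w') 2).trans (dist_le_pi_dist x y w')
    · rw [negXAt_apply_of_ne hw, negXAt_apply_of_ne hw]
      exact dist_le_pi_dist x y w'
  refine le_antisymm (key x y) ?_
  have := key (negXAt w x) (negXAt w y)
  rwa [negXAt_negXAt, negXAt_negXAt] at this

/-- **(W0d) FIBRE = ORBIT, invariant-set form**: a set of chart points stable under the moves of the chart `S` (angle shifts, flips at compact places, sign changes at split places) that
contains ONE point of a fibre of `bzClassMap S` contains the whole fibre — ★ `apply_eq_of_bzClassMap_eq` (two points with the same class data are related by the moves) applied to the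
indicator of the set. [cite: Bouaziz1994IntegralesOrbitales, §5.1 p. 588] [cite: Shelstad1979, §4 pp. 22–23] -/
theorem mem_of_bzClassMap_eq_of_invariant (S : Finset W) {U : Set (W → Fin 3 → ℝ)}
    (hP : ∀ c ∈ U, ∀ (w : W) (i : Fin 3) (k : ℤ), (w ∉ S ∨ i ≠ 0) → c + angleShift w i k ∈ U)
    (hF : ∀ c ∈ U, ∀ w, w ∉ S → flipAt w c ∈ U) (hX : ∀ c ∈ U, ∀ w, w ∈ S → negXAt w c ∈ U)
    {c₀ c : W → Fin 3 → ℝ} (hc₀ : c₀ ∈ U) (h : bzClassMap S c = bzClassMap S c₀) : c ∈ U := by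
  classical
  set g : (W → Fin 3 → ℝ) → ℂ := U.indicator (fun _ => (1 : ℂ)) with hg
  have hgP : ∀ (c : W → Fin 3 → ℝ) (w : W) (i : Fin 3) (k : ℤ), (w ∉ S ∨ i ≠ 0) → g (c + angleShift w i k) = g c := by
    intro c w i k hwi
    have hiff : c + angleShift w i k ∈ U ↔ c ∈ U :=
      ⟨fun hc => by simpa only [add_angleShift_add_angleShift_neg] using hP _ hc w i (-k) hwi, fun hc => hP c hc w i k hwi⟩
    simp only [hg, Set.indicator_apply, hiff]
  have hgF : ∀ (c : W → Fin 3 → ℝ) (w : W), w ∉ S → g (flipAt w c) = g c := by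
    intro c w hw
    have hiff : flipAt w c ∈ U ↔ c ∈ U := ⟨fun hc => by simpa only [flipAt_flipAt] using hF _ hc w hw, fun hc => hF c hc w hw⟩
    simp only [hg, Set.indicator_apply, hiff]
  have hgX : ∀ (c : W → Fin 3 → ℝ) (w : W), w ∈ S → g (negXAt w c) = g c := by
    intro c w hw
    have hiff : negXAt w c ∈ U ↔ c ∈ U := ⟨fun hc => by simpa only [negXAt_negXAt] using hX _ hc w hw, fun hc => hX c hc w hw⟩
    simp only [hg, Set.indicator_apply, hiff]
  have key := apply_eq_of_bzClassMap_eq S hgP hgF hgX h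
  -- `g c₀ = 1`, hence `g c = 1`, hence `c ∈ U`
  by_contra hc
  rw [hg, Set.indicator_of_mem hc₀, Set.indicator_of_notMem hc] at key
  exact one_ne_zero key

/-- **THE `δ`-BALLS OF ALL FIBRE POINTS**: if `U` is stable under the moves of the chart `S` and contains the `δ`-ball around `c₀`, it contains the `δ`-ball around every point `c′` of the
fibre of `c₀` — the moves are isometries, so `{c | ball c δ ⊆ U}` is again stable, and (W0d) applies to it. [cite: Shelstad1979, §4 pp. 22–23] [cite: Bouaziz1994IntegralesOrbitales, §5.1 p. 588] -/
theorem ball_subset_of_bzClassMap_eq_of_invariant (S : Finset W) {U : Set (W → Fin 3 → ℝ)}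
    (hP : ∀ c ∈ U, ∀ (w : W) (i : Fin 3) (k : ℤ), (w ∉ S ∨ i ≠ 0) → c + angleShift w i k ∈ U)
    (hF : ∀ c ∈ U, ∀ w, w ∉ S → flipAt w c ∈ U) (hX : ∀ c ∈ U, ∀ w, w ∈ S → negXAt w c ∈ U)
    {c₀ c' : W → Fin 3 → ℝ} {δ : ℝ} (hball : Metric.ball c₀ δ ⊆ U) (h : bzClassMap S c' = bzClassMap S c₀) : Metric.ball c' δ ⊆ U := by
  -- the stable set `U′ = {c | ball c δ ⊆ U}`
  set U' : Set (W → Fin 3 → ℝ) := {c | Metric.ball c δ ⊆ U} with hU'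
  have hP' : ∀ c ∈ U', ∀ (w : W) (i : Fin 3) (k : ℤ), (w ∉ S ∨ i ≠ 0) → c + angleShift w i k ∈ U' := by
    intro c hc w i k hwi x hx
    have hx' : x + angleShift w i (-k) ∈ Metric.ball c δ := by
      rw [Metric.mem_ball] at hx ⊢
      rwa [← add_angleShift_add_angleShift_neg c w i k, dist_add_right]
    simpa only [add_angleShift_neg_add_angleShift] using hP _ (hc hx') w i k hwi
  have hF' : ∀ c ∈ U', ∀ w, w ∉ S → flipAt w c ∈ U' := by
    intro c hc w hw x hx
    have hx' : flipAt w x ∈ Metric.ball c δ := by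
      rw [Metric.mem_ball] at hx ⊢
      rwa [← dist_flipAt_flipAt w, flipAt_flipAt]
    simpa only [flipAt_flipAt] using hF _ (hc hx') w hw
  have hX' : ∀ c ∈ U', ∀ w, w ∈ S → negXAt w c ∈ U' := by
    intro c hc w hw x hx
    have hx' : negXAt w x ∈ Metric.ball c δ := by
      rw [Metric.mem_ball] at hx ⊢
      rwa [← dist_negXAt_negXAt w, negXAt_negXAt]
    simpa only [negXAt_negXAt] using hX _ (hc hx') w hw
  exact mem_of_bzClassMap_eq_of_invariant S hP' hF' hX' (c₀ := c₀) hball h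

/-- **(W0-main) A MOVE-INVARIANT SET CONTAINING A BALL AROUND ONE FIBRE POINT CONTAINS A CLASS TUBE — radius fixed BEFORE the set** («`∀ δ, ∃ ε, ∀ U`», binder's cut
2026-09-02T13:13:25Z: the consumer's invariant set depends on the family, while the radius of `hwall` must not).  For `bzClassMap S c₀ = b` and `δ > 0` there is `ε > 0` such that EVERY
set `U` stable under the moves of the chart `S` and containing the `δ`-ball around `c₀` contains the whole tube `{c | dist (bzClassMap S c) b < ε}`: `ε` is (W0b)'s (it never sees `U`),
and the `δ`-ball of the fibre point `δ`-near `c` lies in `U` by `ball_subset_of_bzClassMap_eq_of_invariant`.  This is how a (P)(W)-symmetric local statement proved near ONE fibre point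
`c_T` of the chart `S_T` ((W12-asm)'s `{c | c ∈ RegS S → D S c = U_D (cl c) · Q c}`, (W3-asm)'s (G1) tube) becomes the clause «`∀ c ∈ RegS S_T, dist (bzClassMap S_T c) b < ε → …`» of
the organ `hwall`. [cite: Bouaziz1994IntegralesOrbitales, §2.3 Lemme 2.3.1; §5.1 p. 588] [cite: Shelstad1979, §4 pp. 22–25] -/
theorem exists_forall_mem_of_dist_bzClassMap_lt (S : Finset W) {b : W → ℂ × ℂ × ℂ} {c₀ : W → Fin 3 → ℝ} (hc₀ : bzClassMap S c₀ = b) {δ : ℝ} (hδ : 0 < δ) :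
    ∃ ε : ℝ, 0 < ε ∧ ∀ U : Set (W → Fin 3 → ℝ),
      (∀ c ∈ U, ∀ (w : W) (i : Fin 3) (k : ℤ), (w ∉ S ∨ i ≠ 0) → c + angleShift w i k ∈ U) →
      (∀ c ∈ U, ∀ w, w ∉ S → flipAt w c ∈ U) → (∀ c ∈ U, ∀ w, w ∈ S → negXAt w c ∈ U) →
      Metric.ball c₀ δ ⊆ U → ∀ c : W → Fin 3 → ℝ, dist (bzClassMap S c) b < ε → c ∈ U := by
  obtain ⟨ε, hε, hnear⟩ := exists_forall_exists_eq_dist_lt_of_dist_bzClassMap_lt b S hδ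
  refine ⟨ε, hε, fun U hP hF hX hball c hc => ?_⟩
  obtain ⟨c', hc'b, hcc'⟩ := hnear c hc
  exact ball_subset_of_bzClassMap_eq_of_invariant S hP hF hX hball (by rw [hc'b, hc₀]) (Metric.mem_ball.2 hcc')

end Invariant

end Literature.NumberTheory.Rogawski1990

end
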